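import Literature.AlgebraicGeometry.Motives.AbelianVarietyKottwitzAlongEmbedding        -- ★ (U1-c) `charpoly_cotangentMap_eq_prod_embeddings_iff_baseChangeAlong`
import Literature.AlgebraicGeometry.AbelianSchemes.AbelianSchemeFibreFieldChange         -- ★ `fibreFieldChangeIso` (fibre at `Spec φ ≫ s` = base change along `φ`)
import Literature.AlgebraicGeometry.AbelianSchemes.AbelianSchemeFibreHom                 -- ★ `fibreHom`
import Literature.AlgebraicGeometry.AbelianSchemes.AbelianSchemeFixedPowBaseChange        -- ★ `RingAction.baseChange`
import Literature.AlgebraicGeometry.Motives.AbelianVarietyAnalyticCharacterInvariance   -- ★ `charpoly_cotangentMap_eq_of_comp_eq_nsmul`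
import Literature.FieldTheory.AlgClosed.PadicAlgClosureEmbedsComplex                    -- ★ p846856 `nonempty_ringHom_algebraicClosure_adicCompletion_complex`, ★ `exists_ringEquiv_apply_eq`
import Mathlib.FieldTheory.Normal.Basic
import HarnessLib

/-!
# Crux `HLiu418` — P6 sub-line **F0-P6a**, P-line organ for `stub_KOTT` (GEOMETRIC HALF): Kottwitz at EVERY `Ω`-point of EVERY sheet
# from Kottwitz at the `ℂ`-points of the E-witness

Cell `hodgecm-mathlib`, crux `stmt-HodgeConjecture-24832` (HLiu418), sub-line P6a.  GEN heir A-p18 (g31), `--supports stmt-HodgeConjecture-24832`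
(count-neutral).  CONSUMER: the P-line («M-35», `Lines/F0_P6a_PELInputs.lean`, row G4 `kottwitzΩ : KottwitzΩ S Kc 𝓜 w univ act m`): the
spine reads Kottwitz at ALL `Ω = F̄_w`-points of the thickened generic fibre (every sheet `e′ : Fᵢ → Ω`), while the E-witness
(`Lines/F0_P6a_PELWitnessE.lean`, `PELWitnessE.kottwitz`) gives it at the `ℂ`-points of `X ⊗_F Fᵢ` ALONG ONE complex embedding `τE : Fᵢ → ℂ`, in
`fibre`∕`fibreHom` currency, with exponents `r := mOf ι₁ Φ : (F →+* ℂ) → ℕ`.  This file is the transfer, THEOREMS ONLY (no definition, no `sorry`):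

* §1 `exists_ringHom_comp_eq` — for every sheet `e : Fᵢ →+* Ω` there is `σ : Ω →+* ℂ` with `σ ∘ e = τE` (★ p846856 + ★ `exists_ringEquiv_apply_eq`:
  any embedding corrected by an automorphism of `ℂ`); so EVERY sheet is reached, no propagation through generic points is needed.
* §2 `comp_eq_comp_of_isGalois` — for `F` Galois over `ℚ`, `σ ∘ τ` (`τ : F →+* Ω`) depends only on `σ|_{τ₀(F)}`: the exponents
  `m τ := r (σ ∘ τ)` are CANONICAL (independent of the sheet-dependent `σ`) once `σ ∘ τ_w = ι₁` is fixed (Mathlib `AlgHom.restrictNormal`).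
* §3 the currency dictionary, both by `rfl`: `fibreHom (act.i b) s = homMk (Grp.ofHom ((act.baseChange s).i b))` and the equality of the two
  characteristic polynomials — the E-line՚s `fibre`∕`fibreHom` tokens ARE the spine՚s `baseChange`∕`.i` tokens (★ `fibre := (baseChange s).toAffine`).
* §4 `fibreHom_baseChangeAlong_comp_fibreFieldChangeIso_hom` — NATURALITY of ★ `fibreFieldChangeIso` in the homomorphism (★ `pullbackFacObjIso_naturality`),
  and `charpoly_fibreHom_specAlong_eq_prod_iff` — Kottwitz in root form at the fibre over `Spec φ ≫ s` ⇔ at the fibre over `s` with exponents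
  `r ∘ (φ ∘ ·)` (★ (U1-c) + conjugation invariance ★ `charpoly_cotangentMap_eq_of_comp_eq_nsmul` at `n = 1`).
* §5 **`charpoly_fibreHom_eq_prod_of_complexPoints` (HEAD)** — for an abelian scheme `A` with a ring action over an `Fᵢ`-scheme `X`, Kottwitz at the
  `ℂ`-points of `X` over `τE` with exponents `r` implies Kottwitz at every `Ω`-point of `X` over `e` with exponents `r ∘ (σ ∘ ·)`, for any `σ` with
  `σ ∘ e = τE`; `charpoly_fibreHom_eq_prod_of_complexPoints_of_isGalois` rewrites the exponents through ANY `σ′` agreeing with `σ` on `τ₀(F)`.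

[cite: Kottwitz1992, §5 pp. 389–391] [cite: RapoportSmithlingZhang2020Diagonal, §4.1 p. 17; Remark 3.6 (i) (3.14) p. 13] [cite: Shimura1998, §8.5 p. 89]
-/

set_option autoImplicit false

-- `Summit.HodgeConjecture.HodgeConjecture.…` repeats `HodgeConjecture` by design (D-0017).
set_option linter.dupNamespace false

noncomputable section

open CategoryTheory CategoryTheory.Limits AlgebraicGeometry NumberField IsDedekindDomain Cardinal
open Literature.AlgebraicGeometry.Motives Literature.AlgebraicGeometry.Motives.AbelianVariety
open Literature.AlgebraicGeometry.AbelianSchemes Literature.AlgebraicGeometry.AbelianSchemes.AbelianSchemeOver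
open Literature.AlgebraicGeometry.Limits
open Literature.FieldTheory.AlgClosed

namespace Summit.HodgeConjecture.HodgeConjecture.Theorems.F0P6aKottwitzAtOmegaOfComplexPoints

/-! ### §1 Every sheet is reached by a complex embedding of `F̄_w` -/

/-- **`∃ σ : F̄_w →+* ℂ` with `σ ∘ e = τE`** for every embedding `e : Fᵢ → F̄_w` of a number field and every complex embedding `τE` of it:
take any `ι₀ : F̄_w →+* ℂ` (★ p846856) and correct it by the automorphism of `ℂ` carrying `ι₀ ∘ e` to `τE` (★ `exists_ringEquiv_apply_eq`;
`#Fᵢ ≤ ℵ₀ < #ℂ`). [cite: Shimura1998, §8.5 p. 89] -/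
theorem exists_ringHom_comp_eq (F : Type) [Field F] [NumberField F] (w : HeightOneSpectrum (𝓞 F))
    (Fi : Type) [Field Fi] [NumberField Fi] (e : Fi →+* AlgebraicClosure (w.adicCompletion F)) (τE : Fi →+* ℂ) :
    ∃ σ : AlgebraicClosure (w.adicCompletion F) →+* ℂ, σ.comp e = τE := by
  obtain ⟨ι₀⟩ := nonempty_ringHom_algebraicClosure_adicCompletion_complex F w
  have hℂ : ℵ₀ < #ℂ := by rw [Cardinal.mk_complex]; exact Cardinal.aleph0_lt_continuum
  have hFi : #Fi ≤ ℵ₀ := (Algebra.IsAlgebraic.cardinalMk_le_max ℚ Fi).trans (max_le Cardinal.mk_le_aleph0 le_rfl)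
  obtain ⟨σ, hσ⟩ := exists_ringEquiv_apply_eq hℂ hFi (ι₀.comp e) τE
  exact ⟨σ.toRingHom.comp ι₀, RingHom.ext fun x => hσ x⟩

/-! ### §2 For `F` Galois the transported exponents are canonical -/

/-- **`σ ∘ τ = σ′ ∘ τ` for all `τ : F →+* Ω` as soon as `σ ∘ τ₀ = σ′ ∘ τ₀`**, when `F ∕ ℚ` is Galois: every `τ` is `τ₀ ∘ g` for an automorphism `g`
of `F` (normality, Mathlib `AlgHom.restrictNormal`).  So `m τ := r (σ ∘ τ)` does not depend on the sheet-dependent choice of `σ` over `ι₁`.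
[cite: RapoportSmithlingZhang2020Diagonal, Remark 3.6 (i) (3.14) p. 13] -/
theorem comp_eq_comp_of_isGalois (F : Type) [Field F] [NumberField F] [IsGalois ℚ F] {Ω L : Type} [Field Ω] [CharZero Ω] [Field L]
    (τ₀ : F →+* Ω) (σ σ' : Ω →+* L) (h : σ.comp τ₀ = σ'.comp τ₀) (τ : F →+* Ω) : σ.comp τ = σ'.comp τ := by
  letI : Algebra F Ω := τ₀.toAlgebra
  let g : F →ₐ[ℚ] F := (τ.toRatAlgHom).restrictNormal F
  have hg : ∀ x, τ₀ (g x) = τ x := fun x => AlgHom.restrictNormal_commutes τ.toRatAlgHom F x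
  ext x
  rw [RingHom.comp_apply, RingHom.comp_apply, ← hg]
  exact RingHom.congr_fun h (g x)

/-! ### §3 The currency dictionary: `fibre`∕`fibreHom` (E-line) = `baseChange`∕`.i` (spine), by `rfl` -/

section Currency

variable {T : Scheme.{0}} {A : AbelianSchemeOver T} {O : Type} [CommRing O] (act : RingAction O A)
  {Ω : Type} [Field Ω] (s : Spec (.of Ω) ⟶ T) (b : O)

/-- `fibreHom (act.i b) s` IS `homMk (Grp.ofHom ((act.baseChange s).i b))` (★ `fibre s := (baseChange s).toAffine`). [cite: Kottwitz1992, §5 p. 390] -/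
theorem fibreHom_i_eq_homMk_baseChange_i :
    haveI := act.isMonHom b
    haveI := (act.baseChange s).isMonHom_i b
    fibreHom (act.i b) s =
      InducedCategory.homMk (X := (A.fibre s).toAbelianVariety) (Y := (A.fibre s).toAbelianVariety)
        (Grp.ofHom (A := (A.baseChange s).X) (B := (A.baseChange s).X) ((act.baseChange s).i b)) :=
  rfl

/-- The E-line՚s Kottwitz LHS IS the spine՚s Kottwitz LHS at the same point. [cite: Kottwitz1992, §5 p. 390] -/
theorem charpoly_cotangentMap_fibreHom_eq_baseChange :
    haveI := act.isMonHom b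
    haveI := (act.baseChange s).isMonHom_i b
    (cotangentMap (A.fibre s).toAbelianVariety (fibreHom (act.i b) s)).charpoly =
      (cotangentMap (A.baseChange s).toAffine.toAbelianVariety
        (InducedCategory.homMk (Grp.ofHom (A := (A.baseChange s).X) (B := (A.baseChange s).X) ((act.baseChange s).i b)))).charpoly :=
  rfl

end Currency

/-! ### §4 Kottwitz at the fibre over `Spec φ ≫ s` ⇔ at the fibre over `s` -/

section FieldChange

variable {T : Scheme.{0}} {A B : AbelianSchemeOver T} {Ω Ω'' : Type} [Field Ω] [Field Ω''] (φ : Ω →+* Ω'') (s : Spec (.of Ω) ⟶ T)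

/-- **NATURALITY of ★ `fibreFieldChangeIso`**: `(f_s)_φ ≫ e_B = e_A ≫ f_{Spec φ ≫ s}` (★ `pullbackFacObjIso_naturality` under the group-object functors).
[cite: Kottwitz1992, §5 p. 390] -/
theorem fibreHom_baseChangeAlong_comp_fibreFieldChangeIso_hom (f : A.X ⟶ B.X) [IsMonHom f] :
    AbelianVariety.Hom.baseChangeAlong φ (fibreHom f s) ≫ (B.fibreFieldChangeIso φ s).hom =
      (A.fibreFieldChangeIso φ s).hom ≫ fibreHom f (specAlong φ ≫ s) := by
  apply AbelianVariety.hom_ext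
  exact pullbackFacObjIso_naturality s (specAlong φ) (specAlong φ ≫ s) rfl f

/-- **KOTTWITZ IN ROOT FORM AT THE FIBRE OVER `Spec φ ≫ s` ⇔ AT THE FIBRE OVER `s` with exponents `r ∘ (φ ∘ ·)`** (`Ω`, `Ω″` algebraically closed of
characteristic `0`, `a ∈ F` a number field element read through the embeddings): ★ (U1-c) along `φ` for the abelian VARIETY `A_s`, moved to the fibre over
`Spec φ ≫ s` by ★ `fibreFieldChangeIso` (conjugation invariance of the cotangent characteristic polynomial). [cite: Kottwitz1992, §5 p. 390]
[cite: RapoportSmithlingZhang2020Diagonal, §4.1 p. 17] -/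
theorem charpoly_fibreHom_specAlong_eq_prod_iff [IsAlgClosed Ω] [IsAlgClosed Ω''] [CharZero Ω] [CharZero Ω''] (f : A.X ⟶ A.X) [IsMonHom f]
    (F : Type) [Field F] [NumberField F] (a : F) (r : (F →+* Ω'') → ℕ) :
    (cotangentMap (A.fibre (specAlong φ ≫ s)).toAbelianVariety (fibreHom f (specAlong φ ≫ s))).charpoly =
        ∏ τ' : F →+* Ω'', (Polynomial.X - Polynomial.C (τ' a)) ^ r τ' ↔
      (cotangentMap (A.fibre s).toAbelianVariety (fibreHom f s)).charpoly =
        ∏ τ : F →+* Ω, (Polynomial.X - Polynomial.C (τ a)) ^ r (φ.comp τ) := by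
  rw [← charpoly_cotangentMap_eq_prod_embeddings_iff_baseChangeAlong φ (fibreHom f s) a r,
    charpoly_cotangentMap_eq_of_comp_eq_nsmul (φ := (A.fibreFieldChangeIso φ s).hom) (ψ := (A.fibreFieldChangeIso φ s).inv)
      (n := 1) (u := AbelianVariety.Hom.baseChangeAlong φ (fibreHom f s)) (u' := fibreHom f (specAlong φ ≫ s))
      (by rw [Iso.hom_inv_id, one_smul]) (by rw [Iso.inv_hom_id, one_smul]) (by norm_num)
      (fibreHom_baseChangeAlong_comp_fibreFieldChangeIso_hom φ s f)]

end FieldChange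

/-! ### §5 THE HEAD: Kottwitz at every `Ω`-point of every sheet from the `ℂ`-points over `τE` -/

section Head

variable {Fi : Type} [Field Fi] {X : Scheme.{0}} (π : X ⟶ Spec (.of Fi)) (A : AbelianSchemeOver X)
  {O : Type} [CommRing O] (act : RingAction O A) {F : Type} [Field F] [NumberField F] (val : O → F)
  {Ω : Type} [Field Ω] [IsAlgClosed Ω] [CharZero Ω] (e : Fi →+* Ω) (τE : Fi →+* ℂ) (σ : Ω →+* ℂ)
  (r : (F →+* ℂ) → ℕ)

/-- **KOTTWITZ AT EVERY `Ω`-POINT OVER `e` FROM THE `ℂ`-POINTS OVER `τE`** (HEAD): let `A → X` be an abelian scheme over an `Fᵢ`-scheme `π : X → Spec Fᵢ`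
with a ring action `act` of `O` read in the number field `F` through `val`, and suppose that at every `ℂ`-point `t` of `X` over `τE` the endomorphism
`ι(b)` acts on the cotangent space of the fibre with characteristic polynomial `∏_{φ : F → ℂ} (X − φ(val b))^{r φ}` (the E-witness՚s `kottwitz`).  Then for
every `σ : Ω → ℂ` with `σ ∘ e = τE` (§1) and every `Ω`-point `s` of `X` over `e`, the characteristic polynomial at `s` is `∏_{τ : F → Ω} (X − τ(val b))^{r (σ ∘ τ)}`:
the `ℂ`-point `Spec σ ≫ s` lies over `τE`, and §4 pulls the root form back along `σ`. [cite: Kottwitz1992, §5 pp. 389–391]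
[cite: RapoportSmithlingZhang2020Diagonal, §4.1 p. 17] -/
theorem charpoly_fibreHom_eq_prod_of_complexPoints (hσ : σ.comp e = τE)
    (hℂ : ∀ (t : Spec (.of ℂ) ⟶ X), t ≫ π = Spec.map (CommRingCat.ofHom τE) → ∀ b : O, haveI := act.isMonHom b
      (cotangentMap (A.fibre t).toAbelianVariety (fibreHom (act.i b) t)).charpoly =
        ∏ φ : F →+* ℂ, (Polynomial.X - Polynomial.C (φ (val b))) ^ r φ)
    (s : Spec (.of Ω) ⟶ X) (hs : s ≫ π = Spec.map (CommRingCat.ofHom e)) (b : O) :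
    haveI := act.isMonHom b
    (cotangentMap (A.fibre s).toAbelianVariety (fibreHom (act.i b) s)).charpoly =
      ∏ τ : F →+* Ω, (Polynomial.X - Polynomial.C (τ (val b))) ^ r (σ.comp τ) := by
  haveI := act.isMonHom b
  have hx : (specAlong σ ≫ s) ≫ π = Spec.map (CommRingCat.ofHom τE) := by
    rw [Category.assoc, hs, ← hσ, CommRingCat.ofHom_comp, Spec.map_comp]
  exact (charpoly_fibreHom_specAlong_eq_prod_iff σ s (act.i b) F (val b) r).mp (hℂ _ hx b)

/-- **The same with CANONICAL exponents for `F` Galois**: any `σ′ : Ω → ℂ` agreeing with `σ` on `τ₀(F)` (e.g. both `= ι₁` on the structural copy of `F`)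
gives the same right-hand side, so the spine՚s `m τ := r (σ′ ∘ τ)` may be fixed ONCE for all sheets (§2). [cite: RapoportSmithlingZhang2020Diagonal, Remark 3.6 (i) (3.14) p. 13] -/
theorem charpoly_fibreHom_eq_prod_of_complexPoints_of_isGalois [IsGalois ℚ F] (hσ : σ.comp e = τE)
    (hℂ : ∀ (t : Spec (.of ℂ) ⟶ X), t ≫ π = Spec.map (CommRingCat.ofHom τE) → ∀ b : O, haveI := act.isMonHom b
      (cotangentMap (A.fibre t).toAbelianVariety (fibreHom (act.i b) t)).charpoly =
        ∏ φ : F →+* ℂ, (Polynomial.X - Polynomial.C (φ (val b))) ^ r φ)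
    (τ₀ : F →+* Ω) (σ' : Ω →+* ℂ) (hσ' : σ'.comp τ₀ = σ.comp τ₀)
    (s : Spec (.of Ω) ⟶ X) (hs : s ≫ π = Spec.map (CommRingCat.ofHom e)) (b : O) :
    haveI := act.isMonHom b
    (cotangentMap (A.fibre s).toAbelianVariety (fibreHom (act.i b) s)).charpoly =
      ∏ τ : F →+* Ω, (Polynomial.X - Polynomial.C (τ (val b))) ^ r (σ'.comp τ) := by
  rw [charpoly_fibreHom_eq_prod_of_complexPoints π A act val e τE σ r hσ hℂ s hs b]
  refine Finset.prod_congr rfl fun τ _ => ?_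
  rw [comp_eq_comp_of_isGalois F τ₀ σ' σ hσ' τ]

end Head

end Summit.HodgeConjecture.HodgeConjecture.Theorems.F0P6aKottwitzAtOmegaOfComplexPoints

end
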